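import Summits.BirchSwinnertonDyer.Rank1Residual.X11a.SelmerCompanionBound
import HarnessLib

/-!
# Route (3e) SELMER COMPANION, XIII: the refined count — the partner's Selmer group is cut by
# the transported local conditions (class X11a = N7; cell `b2b-bsdres`, unit `b2b-bsdres-x11a`,
# gen 28)

HONEST FRAMING (run/shared/lean/b2b/bsd-rank1-residual/, verbatim in every file): the goal of the
cell is to DELETE the COMBINATION-SHAPED residual classes of the Birch–Swinnerton-Dyer formula for
ALL analytic-rank `≤ 1` elliptic curves over `ℚ` — "full BSD formula for every rank `≤ 1` curve in
class `C`" assembled STRICTLY from published theorems — so that the rank-`≤ 1` remainder becomes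
exactly the CONSTRUCTION-SHAPED classes, which are TYPED (missing-input `Prop`s), NOT attempted.
This is not "finishing BSD". CLASS-OWNERS.md: research routes; NO CLAIM BEYOND STATED CLASSES.
THEOREMS ONLY (no definition, no named fact, no `sorry`); nothing is booked by this file; no label
moves. General (any number field `K : Type`, any odd prime `p`) and cell-independent.

## What this file proves

File I (`X11a/SelmerCompanionBound.lean`) bounds `#Sel^(p)(E'/K) ≤ #Sel^(p)(E/K) · ∏_{v∈S} ι_v(θ)`
along `θ : E'[p] ≅ E[p]` by mapping the subgroup `B = {c ∈ Sel^(p)(E') : θ_* c ∈ 𝓢_v(E) ∀ v ∈ S}`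
injectively into `Sel^(p)(E)`. The image of `B` is in fact contained in the SMALLER group
`Sel^(p)(E) ∩ θ_* 𝓢_{v₀}(E')` for every finite place `v₀` (Selmer classes of `E'` satisfy the local
condition of `E'` at `v₀`). Hence (`natCard_selmerGroup_le_of_congr_inf`)

  **`#Sel^(p)(E'/K) ≤ #(Sel^(p)(E/K) ∩ θ_* 𝓢_{v₀}(E')) · ∏_{v ∈ S} ι_v(θ)`**

and the hybrid form with agreement off `T ⊆ S` (`natCard_selmerGroup_le_of_congr_of_le_off_inf`).
The point (the census of gen 28, `HOME/b2b-bsdres-x11a/g28/SELMER-COMPANION-CENSUS-v4.md` §3): when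
the partner `E = A` has Mordell–Weil rank ONE, `#Sel^(p)(A) = p` spends the whole budget of the
route; but if a lossy place `v₀` is one where NO non-zero class of `Sel^(p)(A)` can satisfy the
transported condition of `E'` — e.g. a SPLIT multiplicative level-lowering place of `E'` at which
`A` is good and the generator of `A(K)` is not `p`-divisible locally (file XIV,
`X11a/SelmerCompanionSplitStrict.lean`) — then the factor `#Sel^(p)(A)` disappears from the bound.
This is the comparison of Selmer structures of Mazur–Rubin (*Kolyvagin systems*, §2.3; *Selmer
companions*, 2015) read with the strict structure `𝓕 ∩ 𝓖` on the side of the partner.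

## References

* [MazurRubin2004] B. Mazur, K. Rubin, *Kolyvagin systems*, Mem. AMS 799 (2004), §2.3.
* B. Mazur, K. Rubin, *Selmer companion curves*, Trans. AMS 367 (2015).
* [GrossLMS1991] B. H. Gross, *Kolyvagin's work on modular elliptic curves* (1991), (7.1).
* [SerreGaloisCohomology1997] J.-P. Serre, *Galois Cohomology*, I.§2.4.
* HOME/b2b-bsdres-x11a/REPORT-g28.md.
-/

set_option autoImplicit false

noncomputable section

open scoped Classical

open WeierstrassCurve Literature.NumberTheory.EllipticCurves
  Literature.NumberTheory.GaloisRepresentations Field NumberField IsDedekindDomain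

namespace Summit.BirchSwinnertonDyer.Rank1Residual.X11a.SelmerCompanion

section Main

variable {K : Type} [Field K] [NumberField K] (W W' : WeierstrassCurve K) [W.IsElliptic]
  [W'.IsElliptic] {p : ℕ} [Fact p.Prime]

/-- **The refined upper-bound congruence transport.** With `θ : E'[p] ≃ E[p]`, `S`, `p` odd as in
`natCard_selmerGroup_le_of_congr` (file I) and ANY finite place `v₀`:
**`#Sel^(p)(E'/K) ≤ #(Sel^(p)(E/K) ∩ θ_* 𝓢_{v₀}(E')) · ∏_{v ∈ S} ι_v(θ)`** — the subgroup
`B ≤ Sel^(p)(E')` of index `≤ ∏ ι_v(θ)` of file I is mapped by `θ_*` injectively into the classes of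
`Sel^(p)(E)` which moreover lie in `θ_* 𝓢_{v₀}(E')` (every class of `Sel^(p)(E')` is Selmer for `E'`
at `v₀`). [cite: MazurRubin2004, §2.3] [cite: GrossLMS1991, §7 (7.1)] -/
theorem natCard_selmerGroup_le_of_congr_inf (hp2 : p ≠ 2)
    (θ : geomTorsion W' (p : ℤ) ≃+ geomTorsion W (p : ℤ))
    (hθ : ∀ (σ : absoluteGaloisGroup K) (P : geomTorsion W' (p : ℤ)), θ (σ • P) = σ • θ P)
    (S : Finset (HeightOneSpectrum (𝓞 K)))
    (hS : ∀ v : HeightOneSpectrum (𝓞 K), v ∉ S →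
      W.HasGoodReductionAt v ∧ W'.HasGoodReductionAt v ∧ (p : 𝓞 K) ∉ v.asIdeal)
    (v₀ : HeightOneSpectrum (𝓞 K)) :
    Nat.card (W'.selmerGroup (p : ℤ)) ≤
      Nat.card ((W.selmerGroup (p : ℤ)) ⊓
          ((selmerLocalKer W' (v₀.adicCompletion K) (p : ℤ)).map (h1Equiv θ hθ).toAddMonoidHom) :
          AddSubgroup (galH1Torsion W (p : ℤ))) *
        ∏ v ∈ S, (selmerLocalKer W (v.adicCompletion K) (p : ℤ)).relIndex
          ((selmerLocalKer W' (v.adicCompletion K) (p : ℤ)).map (h1Equiv θ hθ).toAddMonoidHom) := by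
  have hp : p.Prime := Fact.out
  have hn : (p : ℤ) ≠ 0 := by exact_mod_cast hp.ne_zero
  haveI hSelfin : Finite (W.selmerGroup (p : ℤ)) := W.finite_selmerGroup_holds hn
  haveI hSel'fin : Finite (W'.selmerGroup (p : ℤ)) := W'.finite_selmerGroup_holds hn
  set j : W'.selmerGroup (p : ℤ) →+ galH1Torsion W (p : ℤ) :=
    (h1Equiv θ hθ).toAddMonoidHom.comp (W'.selmerGroup (p : ℤ)).subtype with hj
  have hj_apply : ∀ c : W'.selmerGroup (p : ℤ), j c = h1Equiv θ hθ (c : galH1Torsion W' (p : ℤ)) :=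
    fun c ↦ rfl
  set D : ∀ v : HeightOneSpectrum (𝓞 K), AddSubgroup (W'.selmerGroup (p : ℤ)) :=
    fun v ↦ (selmerLocalKer W (v.adicCompletion K) (p : ℤ)).comap j with hD
  have hD_mem : ∀ v c, c ∈ D v ↔
      h1Equiv θ hθ (c : galH1Torsion W' (p : ℤ)) ∈ selmerLocalKer W (v.adicCompletion K) (p : ℤ) :=
    fun v c ↦ Iff.rfl
  set B : AddSubgroup (W'.selmerGroup (p : ℤ)) := ⨅ v : S, D v with hB
  -- (1) `[Sel^(p)(E') : B] ≤ ∏ ι_v(θ)`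
  have hrange : ∀ v : HeightOneSpectrum (𝓞 K), j.range ≤
      (selmerLocalKer W' (v.adicCompletion K) (p : ℤ)).map (h1Equiv θ hθ).toAddMonoidHom := by
    rintro v _ ⟨c, rfl⟩
    exact AddSubgroup.mem_map.mpr ⟨c, ((mem_selmerGroup_iff W' _ _).mp c.2).1 v, rfl⟩
  have hDidx : ∀ v : HeightOneSpectrum (𝓞 K),
      (D v).index ≤ (selmerLocalKer W (v.adicCompletion K) (p : ℤ)).relIndex
          ((selmerLocalKer W' (v.adicCompletion K) (p : ℤ)).map (h1Equiv θ hθ).toAddMonoidHom) ∧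
        (D v).index ≠ 0 := by
    intro v
    have hne := (relIndex_map_selmerLocalKer_ne_zero_and_le W W' θ hθ v).1
    rw [hD, AddSubgroup.index_comap]
    exact ⟨AddSubgroup.relIndex_le_of_le_right (hrange v) hne,
      fun h0 ↦ hne (AddSubgroup.relIndex_eq_zero_of_le_right (hrange v) h0)⟩
  have hBle : B.index ≤ ∏ v ∈ S, (selmerLocalKer W (v.adicCompletion K) (p : ℤ)).relIndex
      ((selmerLocalKer W' (v.adicCompletion K) (p : ℤ)).map (h1Equiv θ hθ).toAddMonoidHom) := by
    refine (AddSubgroup.index_iInf_le _).trans ?_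
    rw [← Finset.prod_coe_sort S]
    exact Finset.prod_le_prod' fun v _ ↦ (hDidx v).1
  -- (2) `θ_*` maps `B` injectively into `Sel^(p)(E) ∩ θ_* 𝓢_{v₀}(E')`
  have hmem : ∀ b : W'.selmerGroup (p : ℤ), b ∈ B → j b ∈ (W.selmerGroup (p : ℤ)) ⊓
      ((selmerLocalKer W' (v₀.adicCompletion K) (p : ℤ)).map (h1Equiv θ hθ).toAddMonoidHom) := by
    intro b hb
    rw [hB, AddSubgroup.mem_iInf] at hb
    refine AddSubgroup.mem_inf.mpr ⟨?_, hrange v₀ ⟨b, rfl⟩⟩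
    rw [hj_apply, mem_selmerGroup_iff]
    refine ⟨fun v ↦ ?_, fun w ↦ mem_selmerLocalKer_infinitePlace_of_odd W hp2 hp w _⟩
    by_cases hv : v ∈ S
    · exact (hD_mem v b).mp (hb ⟨v, hv⟩)
    · obtain ⟨hgood, hgood', hpv⟩ := hS v hv
      have hpv' : ((p : ℤ) : 𝓞 K) ∉ v.asIdeal := by rwa [Int.cast_natCast]
      obtain ⟨𝔓, h𝔓⟩ := v.primesAbove_nonempty
      refine W.unramifiedKer_le_selmerLocalKer hgood hpv' h𝔓 ?_
      rw [← mem_unramifiedKer_iff_h1Equiv_mem, ← W'.selmerLocalKer_eq_unramifiedKer hgood' hpv' h𝔓]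
      exact ((mem_selmerGroup_iff W' _ _).mp b.2).1 v
  have hfinj : Function.Injective (fun b : B ↦ (⟨j b, hmem b b.2⟩ : ((W.selmerGroup (p : ℤ)) ⊓
      ((selmerLocalKer W' (v₀.adicCompletion K) (p : ℤ)).map (h1Equiv θ hθ).toAddMonoidHom) :
        AddSubgroup (galH1Torsion W (p : ℤ))))) := by
    intro b₁ b₂ h
    have h1 : j b₁ = j b₂ := congrArg Subtype.val h
    rw [hj_apply, hj_apply] at h1
    exact Subtype.ext (Subtype.ext ((h1Equiv θ hθ).injective h1))
  haveI : Finite ((W.selmerGroup (p : ℤ)) ⊓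
      ((selmerLocalKer W' (v₀.adicCompletion K) (p : ℤ)).map (h1Equiv θ hθ).toAddMonoidHom) :
        AddSubgroup (galH1Torsion W (p : ℤ))) :=
    Finite.of_injective (fun c ↦ (⟨c.1, (AddSubgroup.mem_inf.mp c.2).1⟩ : W.selmerGroup (p : ℤ)))
      (fun c₁ c₂ h ↦ Subtype.ext (by simpa using congrArg Subtype.val h))
  have hcardB : Nat.card B ≤ Nat.card ((W.selmerGroup (p : ℤ)) ⊓
      ((selmerLocalKer W' (v₀.adicCompletion K) (p : ℤ)).map (h1Equiv θ hθ).toAddMonoidHom) :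
        AddSubgroup (galH1Torsion W (p : ℤ))) :=
    Nat.card_le_card_of_injective _ hfinj
  -- (3) `#Sel^(p)(E') = [Sel^(p)(E') : B] · #B`
  calc Nat.card (W'.selmerGroup (p : ℤ)) = B.index * Nat.card B := (AddSubgroup.index_mul_card B).symm
    _ ≤ (∏ v ∈ S, (selmerLocalKer W (v.adicCompletion K) (p : ℤ)).relIndex
          ((selmerLocalKer W' (v.adicCompletion K) (p : ℤ)).map (h1Equiv θ hθ).toAddMonoidHom)) *
        Nat.card ((W.selmerGroup (p : ℤ)) ⊓
          ((selmerLocalKer W' (v₀.adicCompletion K) (p : ℤ)).map (h1Equiv θ hθ).toAddMonoidHom) :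
            AddSubgroup (galH1Torsion W (p : ℤ))) := Nat.mul_le_mul hBle hcardB
    _ = _ := mul_comm _ _

/-- **Hybrid form of the refined count.** With `θ`, `S`, `T ⊆ S` and agreement of the local
conditions along `θ` off `T` as in `natCard_selmerGroup_le_of_congr_of_le_off` (file I), and any
finite place `v₀`: `#Sel^(p)(E'/K) ≤ #(Sel^(p)(E/K) ∩ θ_* 𝓢_{v₀}(E')) · ∏_{v ∈ T} #𝓛_v(E')`
(`#𝓛_v(E') = #E'(K_v)[p] · #(𝓞_v/p)`). [cite: MazurRubin2004, §2.3] -/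
theorem natCard_selmerGroup_le_of_congr_of_le_off_inf (hp2 : p ≠ 2)
    (θ : geomTorsion W' (p : ℤ) ≃+ geomTorsion W (p : ℤ))
    (hθ : ∀ (σ : absoluteGaloisGroup K) (P : geomTorsion W' (p : ℤ)), θ (σ • P) = σ • θ P)
    (S T : Finset (HeightOneSpectrum (𝓞 K))) (hTS : T ⊆ S)
    (hS : ∀ v : HeightOneSpectrum (𝓞 K), v ∉ S →
      W.HasGoodReductionAt v ∧ W'.HasGoodReductionAt v ∧ (p : 𝓞 K) ∉ v.asIdeal)
    (hagree : ∀ v ∈ S, v ∉ T → ∀ c ∈ selmerLocalKer W' (v.adicCompletion K) (p : ℤ),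
      h1Equiv θ hθ c ∈ selmerLocalKer W (v.adicCompletion K) (p : ℤ))
    (v₀ : HeightOneSpectrum (𝓞 K)) :
    Nat.card (W'.selmerGroup (p : ℤ)) ≤
      Nat.card ((W.selmerGroup (p : ℤ)) ⊓
          ((selmerLocalKer W' (v₀.adicCompletion K) (p : ℤ)).map (h1Equiv θ hθ).toAddMonoidHom) :
          AddSubgroup (galH1Torsion W (p : ℤ))) *
        ∏ v ∈ T, Nat.card (W'.kummerLocalConditionAt (p : ℤ) (v.adicCompletion K)) := by
  refine (natCard_selmerGroup_le_of_congr_inf W W' hp2 θ hθ S hS v₀).trans (Nat.mul_le_mul_left _ ?_)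
  rw [← Finset.prod_sdiff hTS, Finset.prod_eq_one (s := S \ T) (fun v hv ↦ ?_), one_mul]
  · exact Finset.prod_le_prod' fun v _ ↦ (relIndex_map_selmerLocalKer_ne_zero_and_le W W' θ hθ v).2
  · rw [Finset.mem_sdiff] at hv
    exact (relIndex_map_selmerLocalKer_eq_one_iff W W' θ hθ).mpr (hagree v hv.1 hv.2)

/-- **The strict form.** If, at some finite place `v₀`, every class of `Sel^(p)(E/K)` lying in
`θ_* 𝓢_{v₀}(E')` is zero (e.g. `E = A` of rank one whose generator's Kummer class fails the
transported condition of `E'` at `v₀`), then `#Sel^(p)(E'/K) ≤ ∏_{v ∈ T} #𝓛_v(E')` — the partner's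
Selmer group no longer enters the budget. [cite: MazurRubin2004, §2.3] -/
theorem natCard_selmerGroup_le_of_congr_of_le_off_strict (hp2 : p ≠ 2)
    (θ : geomTorsion W' (p : ℤ) ≃+ geomTorsion W (p : ℤ))
    (hθ : ∀ (σ : absoluteGaloisGroup K) (P : geomTorsion W' (p : ℤ)), θ (σ • P) = σ • θ P)
    (S T : Finset (HeightOneSpectrum (𝓞 K))) (hTS : T ⊆ S)
    (hS : ∀ v : HeightOneSpectrum (𝓞 K), v ∉ S →
      W.HasGoodReductionAt v ∧ W'.HasGoodReductionAt v ∧ (p : 𝓞 K) ∉ v.asIdeal)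
    (hagree : ∀ v ∈ S, v ∉ T → ∀ c ∈ selmerLocalKer W' (v.adicCompletion K) (p : ℤ),
      h1Equiv θ hθ c ∈ selmerLocalKer W (v.adicCompletion K) (p : ℤ))
    {v₀ : HeightOneSpectrum (𝓞 K)}
    (hstrict : ∀ c ∈ selmerLocalKer W' (v₀.adicCompletion K) (p : ℤ),
      h1Equiv θ hθ c ∈ W.selmerGroup (p : ℤ) → h1Equiv θ hθ c = 0) :
    Nat.card (W'.selmerGroup (p : ℤ)) ≤
      ∏ v ∈ T, Nat.card (W'.kummerLocalConditionAt (p : ℤ) (v.adicCompletion K)) := by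
  have h := natCard_selmerGroup_le_of_congr_of_le_off_inf W W' hp2 θ hθ S T hTS hS hagree v₀
  have h1 : Nat.card ((W.selmerGroup (p : ℤ)) ⊓
      ((selmerLocalKer W' (v₀.adicCompletion K) (p : ℤ)).map (h1Equiv θ hθ).toAddMonoidHom) :
        AddSubgroup (galH1Torsion W (p : ℤ))) = 1 := by
    rw [Nat.card_eq_one_iff_unique]
    refine ⟨⟨fun a b ↦ ?_⟩, ⟨⟨0, AddSubgroup.zero_mem _⟩⟩⟩
    have hzero : ∀ d : ((W.selmerGroup (p : ℤ)) ⊓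
        ((selmerLocalKer W' (v₀.adicCompletion K) (p : ℤ)).map (h1Equiv θ hθ).toAddMonoidHom) :
          AddSubgroup (galH1Torsion W (p : ℤ))), (d : galH1Torsion W (p : ℤ)) = 0 := by
      intro d
      obtain ⟨hdS, hdm⟩ := AddSubgroup.mem_inf.mp d.2
      obtain ⟨c, hc, hcd⟩ := AddSubgroup.mem_map.mp hdm
      change h1Equiv θ hθ c = (d : galH1Torsion W (p : ℤ)) at hcd
      rw [← hcd] at hdS ⊢
      exact hstrict c hc hdS
    exact Subtype.ext ((hzero a).trans (hzero b).symm)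
  rw [h1, one_mul] at h
  exact h

end Main

end Summit.BirchSwinnertonDyer.Rank1Residual.X11a.SelmerCompanion

end
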